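import Literature.InformationTheory.QuantumCodes.HypergraphProduct

/-!
# Hypergraph product: kernels and row spaces of `H_X`, `H_Z` in matrix form; Poincaré duality

Technical lemmas for the proofs of Tillich–Zémor's Theorems 7 and 9 and Lemma 10
(`Literature.InformationTheory.QuantumCodes.HypergraphProduct`, [TillichZemor2014], held text
arXiv:0903.0566v1). A vector `e` on the qubit set `(E₁ × V₂) ⊕ (V₁ × E₂)` of `Q_{ℋ₁·ℋ₂}` is read as a pair
of matrices `M = (e (inl (α,b)))_{α,b} : Matrix E₁ V₂` (the `E_R` part) and
`N = (e (inr (a,β)))_{a,β} : Matrix V₁ E₂` (the `E_L` part). In this language (all PROVED here):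

* `mem_pcCode_xMatrix_iff` — `e` is a cycle of `ℋ` (`H_X e = 0`) iff `H₁ M + N H₂ᵀ = 0`;
* `mem_rowSpace_zMatrix_iff` — `e` is a sum of chambers (`e ∈ rowsp H_Z`) iff `M = G H₂ᵀ`, `N = H₁ G` for some
  `G : Matrix E₁ E₂`;
* `zMatrix_eq_submatrix_swap`, `xMatrix_eq_submatrix_swap` — TZ Proposition 2 (Poincaré duality) in matrix
  form: the chambers of `ℋ₁·ℋ₂` are the elementary cocycles of `ℋ₁ᵀ·ℋ₂ᵀ` and conversely, i.e. `H_Z(H₁,H₂)`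
  is `H_X(H₁ᵀ,H₂ᵀ)` with the two column blocks exchanged, and dually;
* transport of `pcCode`, `rowSpace`, `hammingNorm`, `cssMinDist` along a re-indexing of the columns, and the
  resulting symmetry `cssMinDist (Q_{ℋ₁·ℋ₂}) = cssMinDist (Q_{ℋ₁ᵀ·ℋ₂ᵀ})`.

References: TZ §3 (product hypergraph, chambers), Prop. 2 (chunk p0006 L95-110), §4 (chunk p0007 L13-22).
-/

namespace Literature.InformationTheory.QuantumCodes

open Matrix
open scoped Kronecker

/-! ### Kronecker products with an identity factor acting on vectors -/

section KroneckerVec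

variable {F : Type*} [CommSemiring F]
variable {l m n p : Type*} [Fintype l] [Fintype m] [Fintype n] [Fintype p]
variable [DecidableEq l] [DecidableEq m] [DecidableEq n] [DecidableEq p]

omit [Fintype l] [Fintype p] [DecidableEq l] [DecidableEq m] [DecidableEq p] in
/-- `((A ⊗ 1) v)_{(i,k)} = ∑ⱼ A i j · v (j,k)`: `A ⊗ 1` acts on the first index (the block calculus of
Kovalev–Pryadko's algebraic form of the hypergraph product). [cite: KovalevPryadko2012, §IV-A eq. (7) and proof of Prop. 1 (arXiv chunk p0007 L10-30, L78-88)] -/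
theorem kronecker_one_mulVec_apply (A : Matrix l m F) (v : m × n → F) (i : l) (k : n) :
    ((A ⊗ₖ (1 : Matrix n n F)) *ᵥ v) (i, k) = ∑ j, A i j * v (j, k) := by
  simp only [Matrix.mulVec, dotProduct, Fintype.sum_prod_type, Matrix.kroneckerMap_apply,
    Matrix.one_apply, mul_ite, mul_one, mul_zero, ite_mul, zero_mul, Finset.sum_ite_eq,
    Finset.mem_univ, if_true]

omit [Fintype m] [Fintype n] [DecidableEq m] [DecidableEq n] [DecidableEq p] in
/-- `((1 ⊗ B) v)_{(i,k)} = ∑ⱼ v (i,j) · B k j`: `1 ⊗ B` acts on the second index. [cite: KovalevPryadko2012, §IV-A eq. (7) and proof of Prop. 1 (arXiv chunk p0007 L10-30, L78-88)] -/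
theorem one_kronecker_mulVec_apply (B : Matrix n p F) (v : l × p → F) (i : l) (k : n) :
    (((1 : Matrix l l F) ⊗ₖ B) *ᵥ v) (i, k) = ∑ j, v (i, j) * B k j := by
  simp only [Matrix.mulVec, dotProduct, Fintype.sum_prod_type, Matrix.kroneckerMap_apply,
    Matrix.one_apply, ite_mul, one_mul, zero_mul]
  rw [Finset.sum_comm]
  simp only [Finset.sum_ite_eq, Finset.mem_univ, if_true]
  exact Finset.sum_congr rfl fun j _ => mul_comm _ _

omit [Fintype m] [Fintype p] [DecidableEq l] [DecidableEq m] [DecidableEq p] in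
/-- `(g (A ⊗ 1))_{(j,k)} = ∑ᵢ A i j · g (i,k)` ("`(aᵀ ⊗ bᵀ)·(E₂ ⊗ ℋ₁)`" in Kovalev–Pryadko's proof of Prop. 1). [cite: KovalevPryadko2012, §IV-A eq. (7) and proof of Prop. 1 (arXiv chunk p0007 L10-30, L78-88)] -/
theorem vecMul_kronecker_one_apply (A : Matrix l m F) (g : l × n → F) (j : m) (k : n) :
    (g ᵥ* (A ⊗ₖ (1 : Matrix n n F))) (j, k) = ∑ i, A i j * g (i, k) := by
  simp only [Matrix.vecMul, dotProduct, Fintype.sum_prod_type, Matrix.kroneckerMap_apply,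
    Matrix.one_apply, mul_ite, mul_one, mul_zero, Finset.sum_ite_eq', Finset.mem_univ, if_true]
  exact Finset.sum_congr rfl fun i _ => mul_comm _ _

omit [Fintype m] [Fintype p] [DecidableEq m] [DecidableEq n] [DecidableEq p] in
/-- `(g (1 ⊗ B))_{(i,k)} = ∑ⱼ g (i,j) · B j k`. [cite: KovalevPryadko2012, §IV-A eq. (7) and proof of Prop. 1 (arXiv chunk p0007 L10-30, L78-88)] -/
theorem vecMul_one_kronecker_apply (B : Matrix n p F) (g : l × n → F) (i : l) (k : p) :
    (g ᵥ* ((1 : Matrix l l F) ⊗ₖ B)) (i, k) = ∑ j, g (i, j) * B j k := by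
  simp only [Matrix.vecMul, dotProduct, Fintype.sum_prod_type, Matrix.kroneckerMap_apply,
    Matrix.one_apply, ite_mul, one_mul, zero_mul, mul_ite, mul_zero]
  rw [Finset.sum_comm]
  simp only [Finset.sum_ite_eq', Finset.mem_univ, if_true]

end KroneckerVec

/-! ### Re-indexing the columns (qubits) -/

section Reindex

variable {F : Type*} [Field F] [DecidableEq F]
variable {r r' q q' : Type*} [Fintype r] [Fintype r'] [Fintype q] [Fintype q']

omit [DecidableEq F] [Fintype r] in
/-- Membership in the code of a column-reindexed matrix (identifying two labellings of the same edge set). [cite: TillichZemor2014, Prop. 2 (arXiv v1 chunk p0006 L95-100: the edge sets of `ℋ` and of its dual are identified)] -/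
theorem mem_pcCode_submatrix_iff (A : Matrix r q F) (σ : q' ≃ q) (e : q' → F) :
    e ∈ pcCode (A.submatrix id σ) ↔ e ∘ σ.symm ∈ pcCode A := by
  rw [mem_pcCode_iff, mem_pcCode_iff, Matrix.submatrix_mulVec_equiv]
  rfl

omit [DecidableEq F] [Fintype q] [Fintype q'] in
/-- Membership in the row space of a column-reindexed matrix (identifying two labellings of the same edge set). [cite: TillichZemor2014, Prop. 2 (arXiv v1 chunk p0006 L95-100: the edge sets of `ℋ` and of its dual are identified)] -/
theorem mem_rowSpace_submatrix_iff (A : Matrix r q F) (σ : q' ≃ q) (e : q' → F) :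
    e ∈ rowSpace (A.submatrix id σ) ↔ e ∘ σ.symm ∈ rowSpace A := by
  rw [mem_rowSpace_iff, mem_rowSpace_iff]
  constructor
  · rintro ⟨y, rfl⟩
    refine ⟨y, ?_⟩
    ext j
    rw [show (A.submatrix id σ) = A.submatrix (Equiv.refl r) σ from rfl, Matrix.submatrix_vecMul_equiv]
    simp
  · rintro ⟨y, hy⟩
    refine ⟨y, ?_⟩
    rw [show (A.submatrix id σ) = A.submatrix (Equiv.refl r) σ from rfl, Matrix.submatrix_vecMul_equiv]
    ext j
    have := congrFun hy (σ j)
    simpa using this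

omit [Field F] [Fintype r] [Fintype r'] in
/-- The Hamming weight is invariant under re-indexing the coordinates. [cite: TillichZemor2014, Prop. 2 (arXiv v1 chunk p0006 L95-100: the edge sets of `ℋ` and of its dual are identified)] -/
theorem hammingNorm_comp_equiv [Zero F] (e : q' → F) (σ : q' ≃ q) :
    hammingNorm (e ∘ σ.symm) = hammingNorm e := by
  unfold hammingNorm
  refine Finset.card_bij (fun j _ => σ.symm j) (fun j hj => by simpa using hj)
    (fun j₁ _ j₂ _ h => σ.symm.injective h) (fun j hj => ⟨σ j, by simpa using hj, by simp⟩)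

/-- The CSS minimum distance is invariant under a simultaneous re-indexing of the qubits.
[cite: TillichZemor2014, §2 (arXiv v1 chunk p0004 L9-18)] -/
theorem cssMinDist_submatrix_equiv (A : Matrix r q F) (B : Matrix r' q F) (σ : q' ≃ q) :
    cssMinDist (A.submatrix id σ) (B.submatrix id σ) = cssMinDist A B := by
  refine le_antisymm (le_cssMinDist_iff.2 fun e he => ?_) (le_cssMinDist_iff.2 fun e he => ?_)
  · -- a witness `e` for `(A,B)` pulls back to the witness `e ∘ σ` for the reindexed pair
    have he' : ((e ∘ σ) ∈ pcCode (A.submatrix id σ) ∧ (e ∘ σ) ∉ rowSpace (B.submatrix id σ)) ∨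
        ((e ∘ σ) ∈ pcCode (B.submatrix id σ) ∧ (e ∘ σ) ∉ rowSpace (A.submatrix id σ)) := by
      simp only [mem_pcCode_submatrix_iff, mem_rowSpace_submatrix_iff]
      have h : (e ∘ σ) ∘ σ.symm = e := by ext j; simp
      rw [h]; exact he
    refine (cssMinDist_le_hammingNorm he').trans (le_of_eq ?_)
    have h := hammingNorm_comp_equiv (e ∘ σ) σ
    have h' : (e ∘ σ) ∘ σ.symm = e := by ext j; simp
    rw [h'] at h
    exact_mod_cast h.symm
  · have he' : ((e ∘ σ.symm) ∈ pcCode A ∧ (e ∘ σ.symm) ∉ rowSpace B) ∨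
        ((e ∘ σ.symm) ∈ pcCode B ∧ (e ∘ σ.symm) ∉ rowSpace A) := by
      simpa only [mem_pcCode_submatrix_iff, mem_rowSpace_submatrix_iff] using he
    refine (cssMinDist_le_hammingNorm he').trans (le_of_eq ?_)
    exact_mod_cast hammingNorm_comp_equiv e σ

end Reindex

/-! ### Cycles and chambers of the product hypergraph in matrix form -/

namespace HypergraphProduct

variable {V₁ E₁ V₂ E₂ : Type*}
variable [Fintype V₁] [Fintype E₁] [Fintype V₂] [Fintype E₂]
variable [DecidableEq V₁] [DecidableEq E₁] [DecidableEq V₂] [DecidableEq E₂]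

/-- The `E_R`-part of a vector on the edges of `ℋ₁·ℋ₂`, as an `E₁ × V₂` matrix. [cite: TillichZemor2014, §3 (arXiv v1 chunk p0006 L62-74)] -/
def partR (e : (E₁ × V₂) ⊕ (V₁ × E₂) → ZMod 2) : Matrix E₁ V₂ (ZMod 2) :=
  Matrix.of fun α b => e (Sum.inl (α, b))

/-- The `E_L`-part of a vector on the edges of `ℋ₁·ℋ₂`, as a `V₁ × E₂` matrix. [cite: TillichZemor2014, §3 (arXiv v1 chunk p0006 L62-74)] -/
def partL (e : (E₁ × V₂) ⊕ (V₁ × E₂) → ZMod 2) : Matrix V₁ E₂ (ZMod 2) :=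
  Matrix.of fun a β => e (Sum.inr (a, β))

/-- Reassembling a vector on the edges `E_R ∪ E_L` of `ℋ₁·ℋ₂` from its two parts. [cite: TillichZemor2014, §3 (arXiv v1 chunk p0006 L62-74)] -/
def glue (M : Matrix E₁ V₂ (ZMod 2)) (N : Matrix V₁ E₂ (ZMod 2)) :
    (E₁ × V₂) ⊕ (V₁ × E₂) → ZMod 2 :=
  Sum.elim (fun p => M p.1 p.2) (fun p => N p.1 p.2)

omit [Fintype V₁] [Fintype E₁] [Fintype V₂] [Fintype E₂]
  [DecidableEq V₁] [DecidableEq E₁] [DecidableEq V₂] [DecidableEq E₂] in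
/-- Unfolding of `partR`. [cite: TillichZemor2014, §3 (arXiv v1 chunk p0006 L62-74)] -/
@[simp] theorem partR_apply (e : (E₁ × V₂) ⊕ (V₁ × E₂) → ZMod 2) (α : E₁) (b : V₂) :
    partR e α b = e (Sum.inl (α, b)) := rfl

omit [Fintype V₁] [Fintype E₁] [Fintype V₂] [Fintype E₂]
  [DecidableEq V₁] [DecidableEq E₁] [DecidableEq V₂] [DecidableEq E₂] in
/-- Unfolding of `partL`. [cite: TillichZemor2014, §3 (arXiv v1 chunk p0006 L62-74)] -/
@[simp] theorem partL_apply (e : (E₁ × V₂) ⊕ (V₁ × E₂) → ZMod 2) (a : V₁) (β : E₂) :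
    partL e a β = e (Sum.inr (a, β)) := rfl

omit [Fintype V₁] [Fintype E₁] [Fintype V₂] [Fintype E₂]
  [DecidableEq V₁] [DecidableEq E₁] [DecidableEq V₂] [DecidableEq E₂] in
/-- `glue` on an `E_R` edge. [cite: TillichZemor2014, §3 (arXiv v1 chunk p0006 L62-74)] -/
@[simp] theorem glue_inl (M : Matrix E₁ V₂ (ZMod 2)) (N : Matrix V₁ E₂ (ZMod 2)) (α : E₁) (b : V₂) :
    glue M N (Sum.inl (α, b)) = M α b := rfl

omit [Fintype V₁] [Fintype E₁] [Fintype V₂] [Fintype E₂]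
  [DecidableEq V₁] [DecidableEq E₁] [DecidableEq V₂] [DecidableEq E₂] in
/-- `glue` on an `E_L` edge. [cite: TillichZemor2014, §3 (arXiv v1 chunk p0006 L62-74)] -/
@[simp] theorem glue_inr (M : Matrix E₁ V₂ (ZMod 2)) (N : Matrix V₁ E₂ (ZMod 2)) (a : V₁) (β : E₂) :
    glue M N (Sum.inr (a, β)) = N a β := rfl

omit [Fintype V₁] [Fintype E₁] [Fintype V₂] [Fintype E₂]
  [DecidableEq V₁] [DecidableEq E₁] [DecidableEq V₂] [DecidableEq E₂] in
/-- The `E_R` part of a glued vector. [cite: TillichZemor2014, §3 (arXiv v1 chunk p0006 L62-74)] -/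
@[simp] theorem partR_glue (M : Matrix E₁ V₂ (ZMod 2)) (N : Matrix V₁ E₂ (ZMod 2)) :
    partR (glue M N) = M := rfl

omit [Fintype V₁] [Fintype E₁] [Fintype V₂] [Fintype E₂]
  [DecidableEq V₁] [DecidableEq E₁] [DecidableEq V₂] [DecidableEq E₂] in
/-- The `E_L` part of a glued vector. [cite: TillichZemor2014, §3 (arXiv v1 chunk p0006 L62-74)] -/
@[simp] theorem partL_glue (M : Matrix E₁ V₂ (ZMod 2)) (N : Matrix V₁ E₂ (ZMod 2)) :
    partL (glue M N) = N := rfl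

omit [Fintype V₁] [Fintype E₁] [Fintype V₂] [Fintype E₂]
  [DecidableEq V₁] [DecidableEq E₁] [DecidableEq V₂] [DecidableEq E₂] in
/-- A vector is the gluing of its two parts. [cite: TillichZemor2014, §3 (arXiv v1 chunk p0006 L62-74)] -/
theorem glue_partR_partL (e : (E₁ × V₂) ⊕ (V₁ × E₂) → ZMod 2) : glue (partR e) (partL e) = e := by
  ext (⟨α, b⟩ | ⟨a, β⟩) <;> rfl

omit [DecidableEq E₁] [DecidableEq E₂] in
/-- **Cycles of `ℋ₁·ℋ₂`.** A vector `e = (M, N)` on the edges is a cycle (`H_X e = 0`) iff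
`H₁ M + N H₂ᵀ = 0` (as `V₁ × V₂` matrices: the vertex `ab` sees the edges `αb`, `a ∈ α`, through `H₁ M`
and the edges `aβ`, `b ∈ β`, through `N H₂ᵀ`). [cite: TillichZemor2014, §3-§4 (arXiv v1 chunk p0006 L56-74, p0007 L1-12)] -/
theorem mem_pcCode_xMatrix_iff (H₁ : Matrix V₁ E₁ (ZMod 2)) (H₂ : Matrix V₂ E₂ (ZMod 2))
    (e : (E₁ × V₂) ⊕ (V₁ × E₂) → ZMod 2) :
    e ∈ pcCode (xMatrix H₁ H₂) ↔ H₁ * partR e + partL e * H₂ᵀ = 0 := by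
  rw [mem_pcCode_iff, xMatrix, Matrix.fromCols_mulVec, ← Matrix.ext_iff]
  simp only [funext_iff, Prod.forall, Pi.add_apply, Pi.zero_apply, Matrix.add_apply,
    Matrix.zero_apply, kronecker_one_mulVec_apply, one_kronecker_mulVec_apply, Matrix.mul_apply,
    Matrix.transpose_apply, Function.comp_apply, partR_apply, partL_apply]

omit [Fintype V₁] [Fintype V₂] [DecidableEq V₁] [DecidableEq V₂] in
/-- **Chambers of `ℋ₁·ℋ₂`.** A vector `e = (M, N)` lies in the chamber code (`e ∈ rowsp H_Z`, a sum of
chambers `∑_{(α,β) ∈ G} C_{αβ}`) iff `M = G H₂ᵀ` and `N = H₁ G` for some `G : Matrix E₁ E₂` (the set / `𝔽₂`-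
combination of chambers). [cite: TillichZemor2014, §3-§4 (arXiv v1 chunk p0006 L82-90, p0007 L13-22)] -/
theorem mem_rowSpace_zMatrix_iff (H₁ : Matrix V₁ E₁ (ZMod 2)) (H₂ : Matrix V₂ E₂ (ZMod 2))
    (e : (E₁ × V₂) ⊕ (V₁ × E₂) → ZMod 2) :
    e ∈ rowSpace (zMatrix H₁ H₂) ↔
      ∃ G : Matrix E₁ E₂ (ZMod 2), partR e = G * H₂ᵀ ∧ partL e = H₁ * G := by
  rw [mem_rowSpace_iff, zMatrix]
  constructor
  · rintro ⟨y, rfl⟩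
    refine ⟨Matrix.of fun α β => y (α, β), ?_, ?_⟩
    · ext α b
      rw [partR_apply, Matrix.vecMul_fromCols, Sum.elim_inl, vecMul_one_kronecker_apply, Matrix.mul_apply]
      rfl
    · ext a β
      rw [partL_apply, Matrix.vecMul_fromCols, Sum.elim_inr, vecMul_kronecker_one_apply, Matrix.mul_apply]
      rfl
  · rintro ⟨G, hR, hL⟩
    refine ⟨fun p => G p.1 p.2, ?_⟩
    rw [← glue_partR_partL e, hR, hL]
    ext (⟨α, b⟩ | ⟨a, β⟩)
    · rw [Matrix.vecMul_fromCols, Sum.elim_inl, vecMul_one_kronecker_apply, glue_inl, Matrix.mul_apply]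
    · rw [Matrix.vecMul_fromCols, Sum.elim_inr, vecMul_kronecker_one_apply, glue_inr, Matrix.mul_apply]
      rfl

/-! ### Poincaré duality (TZ Proposition 2) -/

omit [Fintype V₁] [Fintype E₁] [Fintype V₂] [Fintype E₂] [DecidableEq V₁] [DecidableEq V₂] in
/-- **TZ Proposition 2 (Poincaré duality), chamber side:** the chambers of `ℋ = ℋ₁·ℋ₂` are the elementary
cocycles of `𝒢 = ℋ₁ᵀ·ℋ₂ᵀ` — in matrix form, `H_Z(H₁,H₂)` is `H_X(H₁ᵀ,H₂ᵀ)` with its two column blocks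
exchanged (the edge set of `𝒢`, `(V₁ × E₂) ⊕ (E₁ × V₂)`, is that of `ℋ` with the summands swapped).
Proved (definitional). [cite: TillichZemor2014, Prop. 2 (arXiv v1 chunk p0006 L95-110)] -/
theorem zMatrix_eq_submatrix_swap (H₁ : Matrix V₁ E₁ (ZMod 2)) (H₂ : Matrix V₂ E₂ (ZMod 2)) :
    zMatrix H₁ H₂ = (xMatrix H₁ᵀ H₂ᵀ).submatrix id Sum.swap := by
  ext i (⟨α, b⟩ | ⟨a, β⟩) <;> rfl

omit [Fintype V₁] [Fintype E₁] [Fintype V₂] [Fintype E₂] [DecidableEq E₁] [DecidableEq E₂] in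
/-- **TZ Proposition 2 (Poincaré duality), cocycle side:** the elementary cocycles of `ℋ₁·ℋ₂` are the
chambers of `ℋ₁ᵀ·ℋ₂ᵀ`: `H_X(H₁,H₂)` is `H_Z(H₁ᵀ,H₂ᵀ)` with its column blocks exchanged. Proved.
[cite: TillichZemor2014, Prop. 2 (arXiv v1 chunk p0006 L95-110)] -/
theorem xMatrix_eq_submatrix_swap (H₁ : Matrix V₁ E₁ (ZMod 2)) (H₂ : Matrix V₂ E₂ (ZMod 2)) :
    xMatrix H₁ H₂ = (zMatrix H₁ᵀ H₂ᵀ).submatrix id Sum.swap := by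
  ext i (⟨α, b⟩ | ⟨a, β⟩) <;> rfl

/-- `Sum.swap` as an equivalence between the edge sets of `ℋ₁ᵀ·ℋ₂ᵀ` and `ℋ₁·ℋ₂`. [cite: TillichZemor2014, Prop. 2 (arXiv v1 chunk p0006 L95-100: the edge sets of `ℋ` and of its dual are identified)] -/
def swapEquiv (V₁ E₁ V₂ E₂ : Type*) : ((E₁ × V₂) ⊕ (V₁ × E₂)) ≃ ((V₁ × E₂) ⊕ (E₁ × V₂)) :=
  Equiv.sumComm _ _

/-- "The quantum code `Q_ℋ` is the same as the quantum code `Q_𝒢` associated to the dual hypergraph"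
(with the roles of `X` and `Z` exchanged): the CSS minimum distances agree. Proved.
[cite: TillichZemor2014, §4 (arXiv v1 chunk p0007 L13-15)] -/
theorem cssMinDist_transpose (H₁ : Matrix V₁ E₁ (ZMod 2)) (H₂ : Matrix V₂ E₂ (ZMod 2)) :
    cssMinDist (xMatrix H₁ᵀ H₂ᵀ) (zMatrix H₁ᵀ H₂ᵀ) = cssMinDist (xMatrix H₁ H₂) (zMatrix H₁ H₂) := by
  rw [zMatrix_eq_submatrix_swap H₁ H₂, xMatrix_eq_submatrix_swap H₁ H₂,
    show (Sum.swap : (E₁ × V₂) ⊕ (V₁ × E₂) → (V₁ × E₂) ⊕ (E₁ × V₂)) = swapEquiv V₁ E₁ V₂ E₂ from rfl,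
    cssMinDist_submatrix_equiv, cssMinDist_comm]

end HypergraphProduct

end Literature.InformationTheory.QuantumCodes
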